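import Summits.PneNP.PneNP.Theses.Descriptive
import Summits.PneNP.PneNP.Theorems.CanonicalFormsCanonOfPEqNP
import Literature.Computability.Complexity.KarpCliqueNP
import Literature.Computability.Complexity.CodeFPLists
import Literature.Computability.Complexity.CanonicalCodes
import Literature.Computability.Complexity.NondeterministicProofs
import Literature.Computability.Complexity.ClayProblemProofs
import Literature.Probability.RandomGraphs.PlantedCliqueProgramFP

/-!
# Route Descriptive — `NoCanonGivesPneNP` (stmt-PneNP-9121)

`NoCanonFP → PneNP`. Under `¬ PneNP` we have `P = NP`; the relation "equal, or codes of isomorphic graphs on the same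
`Fin n`" is an equivalence whose pair language is in `NP` BY DEFINITION (certificate = the permutation as a list of images;
verifier = typed `CodeFP` test: well-paired, and either equal strings or two graph codes — tested through the CLIQUE
code test `CliqueNP.codeT` on the padded word `⟨z, bin 0⟩` — with equal vertex count and an adjacency-preserving
permutation), hence in `P`; the `FP` canonical form of route CanonicalForms' `CanonOfPEqNP`
(`canonicalForms_canonOfPEqNP_proof`, Blass–Gurevich) is then a polynomial-time graph canonisation, contradicting
`NoCanonFP`.
-/

set_option linter.dupNamespace false -- `Summit.PneNP.PneNP.…`: summit = sub-problem name (D-0017 single-conjunct layout)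

namespace Summit.PneNP.PneNP.Theorems

open _root_.Computability Polynomial
open Literature.Computability.Complexity Literature.Computability.Complexity.CodeFP
  Literature.Computability.Complexity.Brick
open Literature.Probability.RandomGraphs.PlantedClique (AKSProg.getD_codeFP)

/-- A string is a graph code `code ⟨n, G⟩` iff the padded word `⟨z, bin 0⟩` passes the CLIQUE-instance code test. [folklore] -/
theorem descriptive_graphCode_iff (z : List Bool) :
    CliqueNP.codeT (boolPair z (encodeNat 0)) = [true] ↔ ∃ (n : ℕ) (G : SimpleGraph (Fin n)), z = encodingGraph.encode ⟨n, G⟩ := by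
  rw [CliqueNP.codeT_eq_true_iff]
  constructor
  · rintro ⟨n, G, k, h⟩
    refine ⟨n, G, ?_⟩
    have := congrArg boolUnpair h
    rw [boolUnpair_boolPair, show CliqueNP.instEnc.encode (⟨n, G⟩, k) = boolPair (encodingGraph.encode ⟨n, G⟩) (encodeNat k)
      from rfl, boolUnpair_boolPair] at this
    exact (Prod.mk.inj this).1
  · rintro ⟨n, G, rfl⟩
    exact ⟨n, G, 0, rfl⟩

/-- **The isomorphism test** on `((x, y), σ)` (`x`, `y` read as `⟨bin n, bits⟩`): equal headers, `|σ| = n`, entries `< n`,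
no duplicates, and `bits_x[i n + j] = bits_y[σᵢ n + σⱼ]` for all `i, j < min n |bits_x|`; polynomial time on codes. [cite: Karp1972, §3] [folklore] -/
theorem descriptive_codeFP_isoTest :
    CodeFP (pairE (pairE strE strE) (listE natE)) bitE fun t : (List Bool × List Bool) × List ℕ =>
      decide (decodeNat (fstF t.1.1) = decodeNat (fstF t.1.2)) &&
        (decide (t.2.length = decodeNat (fstF t.1.1)) &&
          (t.2.all (fun a => decide (a < decodeNat (fstF t.1.1))) &&
            (decide t.2.Nodup &&
              (List.range (min (decodeNat (fstF t.1.1)) (sndF t.1.1).length)).all fun i =>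
                (List.range (min (decodeNat (fstF t.1.1)) (sndF t.1.1).length)).all fun j =>
                  decide ((sndF t.1.1).getD (i * decodeNat (fstF t.1.1) + j) false =
                    (sndF t.1.2).getD (t.2.getD i 0 * decodeNat (fstF t.1.1) + t.2.getD j 0) false)))) := by
  have hdec : CodeFP strE natE fun w : List Bool => decodeNat w := CodeFP.of_fn canonF canonF_mem_FP canonF_eq_encodeNat_decodeNat
  have hfst : CodeFP strE strE fun w : List Bool => fstF w := CodeFP.of_fn fstF fstF_mem_FP fun _ => rfl
  have hsnd : CodeFP strE strE fun w : List Bool => sndF w := CodeFP.of_fn sndF sndF_mem_FP fun _ => rfl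
  have hx : CodeFP (pairE (pairE strE strE) (listE natE)) strE fun t : (List Bool × List Bool) × List ℕ => t.1.1 :=
    (CodeFP.fst _ _).fst'
  have hy : CodeFP (pairE (pairE strE strE) (listE natE)) strE fun t : (List Bool × List Bool) × List ℕ => t.1.2 :=
    (CodeFP.fst _ _).snd'
  have hσ : CodeFP (pairE (pairE strE strE) (listE natE)) (rawE natE) fun t : (List Bool × List Bool) × List ℕ => t.2 :=
    ((rawOfList natE).comp (CodeFP.snd _ _) :)
  have hn : CodeFP (pairE (pairE strE strE) (listE natE)) natE fun t : (List Bool × List Bool) × List ℕ =>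
      decodeNat (fstF t.1.1) := (hdec.comp (hfst.comp hx) :)
  have hn' : CodeFP (pairE (pairE strE strE) (listE natE)) natE fun t : (List Bool × List Bool) × List ℕ =>
      decodeNat (fstF t.1.2) := (hdec.comp (hfst.comp hy) :)
  have hbx : CodeFP (pairE (pairE strE strE) (listE natE)) strE fun t : (List Bool × List Bool) × List ℕ => sndF t.1.1 :=
    (hsnd.comp hx :)
  have hby : CodeFP (pairE (pairE strE strE) (listE natE)) strE fun t : (List Bool × List Bool) × List ℕ => sndF t.1.2 :=
    (hsnd.comp hy :)
  have h1 : CodeFP (pairE (pairE strE strE) (listE natE)) bitE fun t : (List Bool × List Bool) × List ℕ =>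
      decide (decodeNat (fstF t.1.1) = decodeNat (fstF t.1.2)) := (natEq.comp (hn.pair hn') :)
  have h2 : CodeFP (pairE (pairE strE strE) (listE natE)) bitE fun t : (List Bool × List Bool) × List ℕ =>
      decide (t.2.length = decodeNat (fstF t.1.1)) := (natEq.comp (((natLength natE).comp hσ).pair hn) :)
  have h3 : CodeFP (pairE (pairE strE strE) (listE natE)) bitE fun t : (List Bool × List Bool) × List ℕ =>
      t.2.all (fun a => decide (a < decodeNat (fstF t.1.1))) :=
    ((CodeFP.all (σ := ℕ) (eσ := natE) (natLt.comp ((CodeFP.snd natE natE).pair (CodeFP.fst natE natE)) :)).comp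
      (hn.pair hσ) :)
  have h4 : CodeFP (pairE (pairE strE strE) (listE natE)) bitE fun t : (List Bool × List Bool) × List ℕ => decide t.2.Nodup :=
    ((CodeFP.nodup natE_injective).comp hσ :)
  have hctx : CodeFP (pairE (pairE strE strE) (listE natE)) (pairE (pairE strE strE) (pairE (rawE natE) natE))
      fun t : (List Bool × List Bool) × List ℕ => ((sndF t.1.1, sndF t.1.2), (t.2, decodeNat (fstF t.1.1))) :=
    (hbx.pair hby).pair (hσ.pair hn)
  have hget : CodeFP (pairE (rawE natE) natE) natE fun p : List ℕ × ℕ => p.1.getD p.2 0 := rawGetD natE rfl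
  have hinner : CodeFP (pairE (pairE (pairE (pairE strE strE) (pairE (rawE natE) natE)) natE) natE) bitE
      fun q : (((List Bool × List Bool) × (List ℕ × ℕ)) × ℕ) × ℕ =>
        decide (q.1.1.1.1.getD (q.1.2 * q.1.1.2.2 + q.2) false =
          q.1.1.1.2.getD (q.1.1.2.1.getD q.1.2 0 * q.1.1.2.2 + q.1.1.2.1.getD q.2 0) false) := by
    have qbx : CodeFP (pairE (pairE (pairE (pairE strE strE) (pairE (rawE natE) natE)) natE) natE) strE
        fun q : (((List Bool × List Bool) × (List ℕ × ℕ)) × ℕ) × ℕ => q.1.1.1.1 := (CodeFP.fst _ _).fst'.fst'.fst'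
    have qby : CodeFP (pairE (pairE (pairE (pairE strE strE) (pairE (rawE natE) natE)) natE) natE) strE
        fun q : (((List Bool × List Bool) × (List ℕ × ℕ)) × ℕ) × ℕ => q.1.1.1.2 := (CodeFP.fst _ _).fst'.fst'.snd'
    have qσ : CodeFP (pairE (pairE (pairE (pairE strE strE) (pairE (rawE natE) natE)) natE) natE) (rawE natE)
        fun q : (((List Bool × List Bool) × (List ℕ × ℕ)) × ℕ) × ℕ => q.1.1.2.1 := (CodeFP.fst _ _).fst'.snd'.fst'
    have qn : CodeFP (pairE (pairE (pairE (pairE strE strE) (pairE (rawE natE) natE)) natE) natE) natE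
        fun q : (((List Bool × List Bool) × (List ℕ × ℕ)) × ℕ) × ℕ => q.1.1.2.2 := (CodeFP.fst _ _).fst'.snd'.snd'
    have qi : CodeFP (pairE (pairE (pairE (pairE strE strE) (pairE (rawE natE) natE)) natE) natE) natE
        fun q : (((List Bool × List Bool) × (List ℕ × ℕ)) × ℕ) × ℕ => q.1.2 := (CodeFP.fst _ _).snd'
    have qj : CodeFP (pairE (pairE (pairE (pairE strE strE) (pairE (rawE natE) natE)) natE) natE) natE
        fun q : (((List Bool × List Bool) × (List ℕ × ℕ)) × ℕ) × ℕ => q.2 := CodeFP.snd _ _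
    have qσi := (hget.comp (qσ.pair qi) :)
    have qσj := (hget.comp (qσ.pair qj) :)
    have hl : CodeFP (pairE (pairE (pairE (pairE strE strE) (pairE (rawE natE) natE)) natE) natE) bitE
        fun q : (((List Bool × List Bool) × (List ℕ × ℕ)) × ℕ) × ℕ => q.1.1.1.1.getD (q.1.2 * q.1.1.2.2 + q.2) false :=
      (AKSProg.getD_codeFP.comp (qbx.pair (natAdd.comp ((natMul.comp (qi.pair qn)).pair qj))) :)
    have hr : CodeFP (pairE (pairE (pairE (pairE strE strE) (pairE (rawE natE) natE)) natE) natE) bitE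
        fun q : (((List Bool × List Bool) × (List ℕ × ℕ)) × ℕ) × ℕ =>
          q.1.1.1.2.getD (q.1.1.2.1.getD q.1.2 0 * q.1.1.2.2 + q.1.1.2.1.getD q.2 0) false :=
      (AKSProg.getD_codeFP.comp (qby.pair (natAdd.comp ((natMul.comp (qσi.pair qn)).pair qσj))) :)
    exact ((CodeFP.eq bitE_injective).comp (hl.pair hr) :)
  have hrangeC : CodeFP (pairE (pairE strE strE) (pairE (rawE natE) natE)) (rawE natE)
      fun c : (List Bool × List Bool) × (List ℕ × ℕ) => List.range (min c.2.2 c.1.1.length) := by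
    have := (rangeOf.comp ((strLength.comp (CodeFP.fst _ _).fst').pair (CodeFP.snd _ _).snd') :
      CodeFP (pairE (pairE strE strE) (pairE (rawE natE) natE)) (rawE natE)
        fun c : (List Bool × List Bool) × (List ℕ × ℕ) => List.range (min c.2.2 c.1.1.length))
    exact this
  have hallj := CodeFP.all hinner
  have hmid : CodeFP (pairE (pairE (pairE strE strE) (pairE (rawE natE) natE)) natE) bitE
      fun q : ((List Bool × List Bool) × (List ℕ × ℕ)) × ℕ =>
        (List.range (min q.1.2.2 q.1.1.1.length)).all fun j =>
          decide (q.1.1.1.getD (q.2 * q.1.2.2 + j) false =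
            q.1.1.2.getD (q.1.2.1.getD q.2 0 * q.1.2.2 + q.1.2.1.getD j 0) false) :=
    (hallj.comp ((CodeFP.id _).pair (hrangeC.comp (CodeFP.fst _ _))) :)
  have halli := CodeFP.all hmid
  have h5 : CodeFP (pairE (pairE strE strE) (listE natE)) bitE fun t : (List Bool × List Bool) × List ℕ =>
      (List.range (min (decodeNat (fstF t.1.1)) (sndF t.1.1).length)).all fun i =>
        (List.range (min (decodeNat (fstF t.1.1)) (sndF t.1.1).length)).all fun j =>
          decide ((sndF t.1.1).getD (i * decodeNat (fstF t.1.1) + j) false =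
            (sndF t.1.2).getD (t.2.getD i 0 * decodeNat (fstF t.1.1) + t.2.getD j 0) false) :=
    ((halli.comp (hctx.pair (hrangeC.comp hctx))) :)
  exact h1.and (h2.and (h3.and (h4.and h5)))

/-- **Semantics of the isomorphism test on genuine codes.** [folklore] -/
theorem descriptive_isoTest_iff {n m : ℕ} (G : SimpleGraph (Fin n)) (H : SimpleGraph (Fin m)) (σ : List ℕ) :
    (decide (decodeNat (fstF (encodingGraph.encode ⟨n, G⟩)) = decodeNat (fstF (encodingGraph.encode ⟨m, H⟩))) &&
        (decide (σ.length = decodeNat (fstF (encodingGraph.encode ⟨n, G⟩))) &&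
          (σ.all (fun a => decide (a < decodeNat (fstF (encodingGraph.encode ⟨n, G⟩)))) &&
            (decide σ.Nodup &&
              (List.range (min (decodeNat (fstF (encodingGraph.encode ⟨n, G⟩))) (sndF (encodingGraph.encode ⟨n, G⟩)).length)).all fun i =>
                (List.range (min (decodeNat (fstF (encodingGraph.encode ⟨n, G⟩))) (sndF (encodingGraph.encode ⟨n, G⟩)).length)).all fun j =>
                  decide ((sndF (encodingGraph.encode ⟨n, G⟩)).getD (i * decodeNat (fstF (encodingGraph.encode ⟨n, G⟩)) + j) false =
                    (sndF (encodingGraph.encode ⟨m, H⟩)).getD (σ.getD i 0 * decodeNat (fstF (encodingGraph.encode ⟨n, G⟩)) + σ.getD j 0) false))))) = true ↔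
      m = n ∧ σ.length = n ∧ (∀ a ∈ σ, a < n) ∧ σ.Nodup ∧
        ∀ i < n, ∀ j < n, (CliqueNP.adjBits n G).getD (i * n + j) false = (CliqueNP.adjBits m H).getD (σ.getD i 0 * n + σ.getD j 0) false := by
  have ex : encodingGraph.encode ⟨n, G⟩ = boolPair (encodeNat n) (CliqueNP.adjBits n G) := by
    rw [encodingGraph_encode, CliqueNP.encodingGraphFin_encode_eq]
  have ey : encodingGraph.encode ⟨m, H⟩ = boolPair (encodeNat m) (CliqueNP.adjBits m H) := by
    rw [encodingGraph_encode, CliqueNP.encodingGraphFin_encode_eq]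
  rw [ex, ey]
  simp only [fstF_boolPair, sndF_boolPair, decode_encodeNat, CliqueNP.length_adjBits, Bool.and_eq_true, decide_eq_true_eq,
    List.all_eq_true, List.mem_range]
  have hmin : min n (n * n) = n := by
    rcases Nat.eq_zero_or_pos n with rfl | hn
    · simp
    · exact min_eq_left (Nat.le_mul_of_pos_left n hn)
  rw [hmin]
  constructor
  · rintro ⟨h1, h2, h3, h4, h5⟩
    exact ⟨h1.symm, h2, h3, h4, fun i hi j hj => h5 i hi j hj⟩
  · rintro ⟨rfl, h2, h3, h4, h5⟩
    exact ⟨rfl, h2, h3, h4, fun i hi j hj => h5 i hi j hj⟩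

/-- From a passing isomorphism test to an isomorphism. [folklore] -/
theorem descriptive_iso_of_test {n : ℕ} (G H : SimpleGraph (Fin n)) (σ : List ℕ) (hlen : σ.length = n)
    (hlt : ∀ a ∈ σ, a < n) (hnd : σ.Nodup)
    (hadj : ∀ i < n, ∀ j < n, (CliqueNP.adjBits n G).getD (i * n + j) false =
      (CliqueNP.adjBits n H).getD (σ.getD i 0 * n + σ.getD j 0) false) : Nonempty (G ≃g H) := by
  classical
  have hget : ∀ i : Fin n, σ.getD i 0 = σ[i.val]'(by rw [hlen]; exact i.isLt) := fun i =>
    List.getD_eq_getElem _ _ (by rw [hlen]; exact i.isLt)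
  let f : Fin n → Fin n := fun i => ⟨σ.getD i 0, hlt _ (by rw [hget i]; exact List.getElem_mem _)⟩
  have hf : Function.Injective f := by
    intro i j h
    have h' : σ.getD i 0 = σ.getD j 0 := congrArg Fin.val h
    rw [hget i, hget j] at h'
    exact Fin.ext ((hnd.getElem_inj_iff).1 h')
  have hbij : Function.Bijective f := hf.bijective_of_finite
  refine ⟨⟨Equiv.ofBijective f hbij, ?_⟩⟩
  intro a b
  have h := hadj a a.isLt b b.isLt
  rw [CliqueNP.getD_adjBits_flat G a b] at h
  have h2 := CliqueNP.getD_adjBits_flat H (f a) (f b)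
  simp only [Equiv.ofBijective_apply]
  change H.Adj (f a) (f b) ↔ G.Adj a b
  have hfa : ((f a : Fin n) : ℕ) = σ.getD a 0 := rfl
  have hfb : ((f b : Fin n) : ℕ) = σ.getD b 0 := rfl
  rw [hfa, hfb] at h2
  rw [h2] at h
  simpa using h.symm

/-- From an isomorphism to a passing test, with the certificate `σ = (φ 0, …, φ (n-1))`. [folklore] -/
theorem descriptive_test_of_iso {n : ℕ} (G H : SimpleGraph (Fin n)) (φ : G ≃g H) :
    (List.ofFn fun i : Fin n => ((φ i : Fin n) : ℕ)).length = n ∧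
      (∀ a ∈ (List.ofFn fun i : Fin n => ((φ i : Fin n) : ℕ)), a < n) ∧
        (List.ofFn fun i : Fin n => ((φ i : Fin n) : ℕ)).Nodup ∧
          ∀ i < n, ∀ j < n, (CliqueNP.adjBits n G).getD (i * n + j) false =
            (CliqueNP.adjBits n H).getD ((List.ofFn fun i : Fin n => ((φ i : Fin n) : ℕ)).getD i 0 * n +
              (List.ofFn fun i : Fin n => ((φ i : Fin n) : ℕ)).getD j 0) false := by
  classical
  set σ := List.ofFn fun i : Fin n => ((φ i : Fin n) : ℕ) with hσ
  have hget : ∀ i : Fin n, σ.getD i 0 = (φ i : Fin n) := fun i => by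
    rw [hσ, List.getD_eq_getElem _ _ (by simp), List.getElem_ofFn]
  refine ⟨by simp [hσ], fun a ha => ?_, ?_, fun i hi j hj => ?_⟩
  · rw [hσ, List.mem_ofFn] at ha
    obtain ⟨i, rfl⟩ := ha
    exact (φ i).isLt
  · rw [hσ, List.nodup_ofFn]
    exact Fin.val_injective.comp φ.injective
  · have h1 := CliqueNP.getD_adjBits_flat G ⟨i, hi⟩ ⟨j, hj⟩
    have h2 := CliqueNP.getD_adjBits_flat H (φ ⟨i, hi⟩) (φ ⟨j, hj⟩)
    rw [← hget ⟨i, hi⟩, ← hget ⟨j, hj⟩] at h2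
    simp only [] at h1 h2
    rw [h1, h2]
    simp [φ.map_rel_iff]

/-- Injectivity of the graph code, with the dependent second component. [folklore] -/
theorem descriptive_encode_inj {n m : ℕ} {G : SimpleGraph (Fin n)} {H : SimpleGraph (Fin m)}
    (h : encodingGraph.encode ⟨n, G⟩ = encodingGraph.encode ⟨m, H⟩) : ∃ e : n = m, e ▸ G = H := by
  have := encodingGraph.encode_injective h
  obtain ⟨rfl, hGH⟩ := Sigma.mk.inj_iff.1 this
  exact ⟨rfl, eq_of_heq hGH⟩

/-- **The relation "equal, or codes of isomorphic graphs on the same vertex set" and its pair language in `NP`.**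
Certificate = the permutation as the list of images (`≤ 8|w|² + 8` symbols); verifier = well-pairedness, then string
equality or (two graph codes ∧ the isomorphism test). [cite: Karp1972, §3 (NP by certificates)] [folklore] -/
theorem descriptive_isoPairLang_mem_NP :
    ({w : List Bool | ∃ x y : List Bool, w = boolPair x y ∧
        (x = y ∨ ∃ (n : ℕ) (G H : SimpleGraph (Fin n)), x = encodingGraph.encode ⟨n, G⟩ ∧
          y = encodingGraph.encode ⟨n, H⟩ ∧ Nonempty (G ≃g H))} : Language Bool) ∈ Nondeterministic.NP := by
  -- the typed verifier on (w, σ)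
  have hfst : CodeFP strE strE fun w : List Bool => fstF w := CodeFP.of_fn fstF fstF_mem_FP fun _ => rfl
  have hsnd : CodeFP strE strE fun w : List Bool => sndF w := CodeFP.of_fn sndF sndF_mem_FP fun _ => rfl
  have hwp : CodeFP strE bitE fun w : List Bool => decide (boolPair (fstF w) (sndF w) = w) :=
    CodeFP.of_fn CliqueNP.wpF CliqueNP.wpF_mem_FP fun w => by rw [CliqueNP.wpF_apply]; rfl
  have hgc : CodeFP strE bitE fun z : List Bool => decide (CliqueNP.CodeOK (boolPair z (encodeNat 0))) :=
    CodeFP.of_fn (CliqueNP.codeT ∘ fanoutFn id fun _ => encodeNat 0)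
      (comp_mem_FP CliqueNP.codeT_mem_FP (fanoutFn_mem_FP (PolyTimeComputable.id _) (const_mem_FP _))) fun z => by
        rw [Function.comp_apply, fanoutFn_apply, CliqueNP.codeT_apply]; rfl
  have hw : CodeFP (pairE strE (listE natE)) strE fun t : List Bool × List ℕ => t.1 := CodeFP.fst _ _
  have hx : CodeFP (pairE strE (listE natE)) strE fun t : List Bool × List ℕ => fstF t.1 := (hfst.comp hw :)
  have hy : CodeFP (pairE strE (listE natE)) strE fun t : List Bool × List ℕ => sndF t.1 := (hsnd.comp hw :)
  have hσ : CodeFP (pairE strE (listE natE)) (listE natE) fun t : List Bool × List ℕ => t.2 := CodeFP.snd _ _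
  have heq : CodeFP (pairE strE (listE natE)) bitE fun t : List Bool × List ℕ => decide (fstF t.1 = sndF t.1) :=
    ((CodeFP.eq (α := List Bool) (eα := strE) Function.injective_id).comp (hx.pair hy) :)
  have hiso := (descriptive_codeFP_isoTest.comp ((hx.pair hy).pair hσ) :)
  have hQ := (hwp.comp hw :).and (heq.or ((hgc.comp hx :).and ((hgc.comp hy :).and hiso)))
  obtain ⟨g, hg, hgspec⟩ := hQ
  -- the verifier language
  set V : Language Bool := (g ∘ fanoutFn fstF (CanonCode.canonListFnC 2 canonF ∘ sndF)) ⁻¹' PRelSigma.HeadIs true with hV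
  have hVP : V ∈ Classes.P :=
    preimage_mem_P (PRelSigma.HeadIs_mem_P true) (comp_mem_FP hg (fanoutFn_mem_FP fstF_mem_FP
      (comp_mem_FP (CanonCode.canonListFnC_mem_FP 2 canonF_mem_FP) sndF_mem_FP)))
  have hcan : ∀ c : List Bool,
      encodingNatBool.listBool.decode c = some (NegCNF.decList decodeNat (boolUnpair c).1.length (boolUnpair c).2) ∧
        CanonCode.canonListFnC 2 canonF c =
          encodingNatBool.listBool.encode (NegCNF.decList decodeNat (boolUnpair c).1.length (boolUnpair c).2) :=
    fun c => CanonCode.canonListFnC_eq encodingNatBool decodeNat (fun _ => rfl) canonF_eq_encodeNat_decodeNat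
      (A := 1) (B := 1) (fun u => by have := length_canonF_le u; omega) (by norm_num) c
  -- value of the verifier
  have hVsem : ∀ w c : List Bool, boolPair w c ∈ V ↔
      (decide (boolPair (fstF w) (sndF w) = w) && (decide (fstF w = sndF w) ||
        (decide (CliqueNP.CodeOK (boolPair (fstF w) (encodeNat 0))) && (decide (CliqueNP.CodeOK (boolPair (sndF w) (encodeNat 0))) &&
          (fun t : (List Bool × List Bool) × List ℕ =>
            decide (decodeNat (fstF t.1.1) = decodeNat (fstF t.1.2)) &&
              (decide (t.2.length = decodeNat (fstF t.1.1)) &&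
                (t.2.all (fun a => decide (a < decodeNat (fstF t.1.1))) &&
                  (decide t.2.Nodup &&
                    (List.range (min (decodeNat (fstF t.1.1)) (sndF t.1.1).length)).all fun i =>
                      (List.range (min (decodeNat (fstF t.1.1)) (sndF t.1.1).length)).all fun j =>
                        decide ((sndF t.1.1).getD (i * decodeNat (fstF t.1.1) + j) false =
                          (sndF t.1.2).getD (t.2.getD i 0 * decodeNat (fstF t.1.1) + t.2.getD j 0) false)))))
            ((fstF w, sndF w), NegCNF.decList decodeNat (boolUnpair c).1.length (boolUnpair c).2))))) = true := by
    intro w c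
    set D := NegCNF.decList decodeNat (boolUnpair c).1.length (boolUnpair c).2 with hD
    change (g ∘ fanoutFn fstF (CanonCode.canonListFnC 2 canonF ∘ sndF)) (boolPair w c) ∈ PRelSigma.HeadIs true ↔ _
    simp only [Function.comp_apply, fanoutFn_apply, fstF_boolPair, sndF_boolPair, PRelSigma.mem_HeadIs]
    rw [(hcan c).2, listE_eq, ← hD, show boolPair w (listE encodingNatBool.encode D) = pairE strE (listE natE) (w, D) from rfl,
      hgspec]
    simp [bitE]
  refine ⟨V, hVP, 8 * X ^ 2 + 8, fun w => ?_⟩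
  constructor
  · rintro ⟨x, y, rfl, hE⟩
    rcases hE with rfl | ⟨n, G, H, rfl, rfl, ⟨φ⟩⟩
    · refine ⟨encodingNatBool.listBool.encode ([] : List ℕ), by simp [listE_eq, listE, unE, rawE, length_boolPair], ?_⟩
      rw [hVsem]
      simp [fstF_boolPair, sndF_boolPair]
    · obtain ⟨hlen, hlt, hnd, hadj⟩ := descriptive_test_of_iso G H φ
      set σ := List.ofFn fun i : Fin n => ((φ i : Fin n) : ℕ) with hσ
      refine ⟨encodingNatBool.listBool.encode σ, ?_, ?_⟩
      · -- the certificate is short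
        have hraw : ∀ l : List ℕ, (∀ a ∈ l, a < n) → (rawE natE l).length ≤ l.length * (2 * n + 2) := by
          intro l hl
          induction l with
          | nil => simp
          | cons a l ih =>
            rw [rawE_cons, length_boolPair, List.length_cons]
            have ha : (natE a).length ≤ n := (length_natE_le a).trans (hl a (List.mem_cons_self ..)).le
            have := ih fun b hb => hl b (List.mem_cons_of_mem _ hb)
            nlinarith
        have h1 := hraw σ hlt
        rw [hlen] at h1
        have h2 : (encodingNatBool.listBool.encode σ).length ≤ 2 * n ^ 2 + 4 * n + 2 := by
          rw [listE_eq, show listE encodingNatBool.encode σ = boolPair (unE σ.length) (rawE natE σ) from rfl, length_boolPair,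
            show (unE σ.length).length = σ.length from unary_decode_encode_nat _, hlen]
          nlinarith
        have h3 : n ^ 2 ≤ (boolPair (encodingGraph.encode ⟨n, G⟩) (encodingGraph.encode ⟨n, H⟩)).length := by
          rw [length_boolPair, encodingGraph_encode, CliqueNP.encodingGraphFin_encode_eq, length_boolPair, CliqueNP.length_adjBits]
          nlinarith
        have h4 : 2 * n ^ 2 + 4 * n + 2 ≤ 8 * (n ^ 2) ^ 2 + 8 := by
          have ha : n ≤ n ^ 2 := Nat.le_self_pow two_ne_zero n
          have hb : n ^ 2 ≤ (n ^ 2) ^ 2 := Nat.le_self_pow two_ne_zero (n ^ 2)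
          linarith
        have h5 : (n ^ 2) ^ 2 ≤ (boolPair (encodingGraph.encode ⟨n, G⟩) (encodingGraph.encode ⟨n, H⟩)).length ^ 2 :=
          Nat.pow_le_pow_left h3 2
        simp only [eval_add, eval_mul, eval_pow, eval_X, eval_ofNat]
        linarith
      · rw [hVsem]
        have hdec : NegCNF.decList decodeNat (boolUnpair (encodingNatBool.listBool.encode σ)).1.length
            (boolUnpair (encodingNatBool.listBool.encode σ)).2 = σ := by
          have h := (hcan (encodingNatBool.listBool.encode σ)).1
          rw [encodingNatBool.listBool.decode_encode] at h
          exact (Option.some.inj h).symm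
        rw [hdec]
        have hgx : decide (CliqueNP.CodeOK (boolPair (encodingGraph.encode ⟨n, G⟩) (encodeNat 0))) = true := by
          rw [← List.singleton_inj (α := Bool), ← CliqueNP.codeT_apply, descriptive_graphCode_iff]; exact ⟨n, G, rfl⟩
        have hgy : decide (CliqueNP.CodeOK (boolPair (encodingGraph.encode ⟨n, H⟩) (encodeNat 0))) = true := by
          rw [← List.singleton_inj (α := Bool), ← CliqueNP.codeT_apply, descriptive_graphCode_iff]; exact ⟨n, H, rfl⟩
        have hit := (descriptive_isoTest_iff G H σ).2 ⟨rfl, hlen, hlt, hnd, hadj⟩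
        dsimp only
        rw [fstF_boolPair, sndF_boolPair, Bool.and_eq_true, Bool.or_eq_true, Bool.and_eq_true, Bool.and_eq_true]
        exact ⟨decide_eq_true rfl, Or.inr ⟨hgx, hgy, hit⟩⟩
  · rintro ⟨c, -, hc⟩
    rw [hVsem] at hc
    dsimp only at hc
    rw [Bool.and_eq_true, Bool.or_eq_true, Bool.and_eq_true, Bool.and_eq_true, decide_eq_true_eq, decide_eq_true_eq] at hc
    obtain ⟨hwp', hrest⟩ := hc
    refine ⟨fstF w, sndF w, hwp'.symm, ?_⟩
    rcases hrest with hxy | ⟨hgx, hgy, hit⟩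
    · exact Or.inl hxy
    · have hgx' : CliqueNP.codeT (boolPair (fstF w) (encodeNat 0)) = [true] := by rw [CliqueNP.codeT_apply, hgx]
      have hgy' : CliqueNP.codeT (boolPair (sndF w) (encodeNat 0)) = [true] := by rw [CliqueNP.codeT_apply, hgy]
      obtain ⟨n, G, hxG⟩ := (descriptive_graphCode_iff _).1 hgx'
      obtain ⟨m, H, hyH⟩ := (descriptive_graphCode_iff _).1 hgy'
      set D := NegCNF.decList decodeNat (boolUnpair c).1.length (boolUnpair c).2 with hD
      rw [hxG, hyH] at hit
      obtain ⟨rfl, hlen, hlt, hnd, hadj⟩ := (descriptive_isoTest_iff G H D).1 hit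
      exact Or.inr ⟨m, G, H, hxG, hyH, descriptive_iso_of_test G H D hlen hlt hnd hadj⟩

/-- The relation "equal, or codes of isomorphic graphs on the same vertex set" is an equivalence relation. [folklore] -/
theorem descriptive_isoRel_equivalence : Equivalence fun x y : List Bool =>
    x = y ∨ ∃ (n : ℕ) (G H : SimpleGraph (Fin n)), x = encodingGraph.encode ⟨n, G⟩ ∧ y = encodingGraph.encode ⟨n, H⟩ ∧ Nonempty (G ≃g H) where
  refl x := Or.inl rfl
  symm := by
    rintro x y (rfl | ⟨n, G, H, rfl, rfl, ⟨φ⟩⟩)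
    · exact Or.inl rfl
    · exact Or.inr ⟨n, H, G, rfl, rfl, ⟨φ.symm⟩⟩
  trans := by
    rintro x y z (rfl | ⟨n, G, H, rfl, rfl, ⟨φ⟩⟩) h2
    · exact h2
    · rcases h2 with rfl | ⟨n', G', H', hy, rfl, ⟨ψ⟩⟩
      · exact Or.inr ⟨n, G, H, rfl, rfl, ⟨φ⟩⟩
      · obtain ⟨rfl, hGH⟩ := descriptive_encode_inj hy
        simp only at hGH
        subst hGH
        exact Or.inr ⟨n, G, H', rfl, rfl, ⟨ψ.comp φ⟩⟩

/-- **Support item `NoCanonGivesPneNP` of route Descriptive (stmt-PneNP-9121)**: `NoCanonFP → PneNP` — under `¬ PneNP`,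
`P = NP`, and the Blass–Gurevich canonical form of route CanonicalForms (`canonicalForms_canonOfPEqNP_proof`) for the
equal-or-isomorphic relation (pair language in `NP = P`, `descriptive_isoPairLang_mem_NP`) is a polynomial-time graph
canonisation. [cite: BlassGurevich1984, §1] [cite: FortnowGrochow2011, §3] -/
theorem descriptive_noCanonGivesPneNP_proof : Summit.PneNP.PneNP.Theses.Descriptive.NoCanonGivesPneNP := by
  intro hX
  by_contra hne
  have hsub : Nondeterministic.NP ⊆ Classes.P := by
    intro L hL
    rw [← show PNPWave0.NP Bool = Nondeterministic.NP from NP_bool_eq_holds] at hL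
    have hLP : L ∈ PNPWave0.P Bool := by
      by_contra h
      exact hne ⟨L, hL, h⟩
    rwa [show PNPWave0.P Bool = Classes.P from P_bool_eq_holds] at hLP
  have hPNP : Classes.P = Nondeterministic.NP := Set.Subset.antisymm P_subset_NP_holds hsub
  obtain ⟨c, hc, hcE, hccan⟩ := canonicalForms_canonOfPEqNP_proof hPNP _ descriptive_isoRel_equivalence
    (hsub descriptive_isoPairLang_mem_NP)
  refine hX ⟨c, hc, fun n G => ⟨?_, fun H hGH => ?_⟩⟩
  · rcases hcE (encodingGraph.encode ⟨n, G⟩) with h | ⟨n', G', H', h1, h2, ⟨φ⟩⟩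
    · exact ⟨G, h, ⟨RelIso.refl _⟩⟩
    · obtain ⟨rfl, hGH⟩ := descriptive_encode_inj h2
      simp only at hGH
      subst hGH
      exact ⟨G', h1, ⟨φ.symm⟩⟩
  · exact hccan _ _ (Or.inr ⟨n, G, H, rfl, rfl, hGH⟩)

end Summit.PneNP.PneNP.Theorems
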